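import Literature.AlgebraicGeometry.Resolution.Principalization
import Literature.AlgebraicGeometry.Resolution.NonPrincipalLocus
import Literature.AlgebraicGeometry.Resolution.MarkedIdealsArithmetic
import Mathlib.AlgebraicGeometry.FunctionField
import HarnessLib

/-!
# Crux `PatchingRelPerfect` (stmt-ResolutionOfSingularities-16161), chain w52 — card C
# (contact-deficit / two-divisor currency): the END criterion, local algebra and sheaf form

[OURS · L1 W5.2 · filed by res-L1-w52-stub-3 for res-L1-w52-idea-1 (RULING G11-12 Q11-b)]
For a one-form member `I = (a₀) + 𝔪ⁿ` the total transform on every model is the sum of two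
invertible ideal sheaves `(a₀)·𝒪_X ⊔ 𝔪ⁿ·𝒪_X`; card C (res-L1-w52-idea-1, Sketch v10) ends the
blow-up sequence when the two are locally COMPARABLE.  This file proves the criterion:

* `span_pair_isPrincipal_iff_dvd_or_dvd` — in a local domain `(x, y)` is principal iff `x ∣ y`
  or `y ∣ x` (Sketch v10 §1, res-L1-w52-idea-1, verbatim);
* `isLocallyPrincipalAt_sup_of_stalkIdeal_le` — if `A`, `B` are locally principal at `x` and
  `A_x ≤ B_x` then `A ⊔ B` is locally principal at `x` (no Noetherian hypothesis: the one
  relation `f_x = c · g_x` spreads to an affine neighbourhood);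
* `isLocallyPrincipal_sup_of_stalkIdeal_le_or_le`, `isLocallyPrincipal_sup_of_isEffectiveCartier`
  — the sheaf form (`PairEnd` of Sketch v10 §2, unfolded: effective Cartier `A`, `B` locally
  comparable ⇒ `A ⊔ B` locally principal);
* `stalkIdeal_le_or_le_of_isPrincipal`, `isLocallyPrincipalAt_sup_iff` — the converse at a
  point whose local ring is a domain, by §1.

Nothing here is a statement of the manuscript under review.

## References

* The Stacks Project, Tag 01WR (locally principal closed subschemes). [StacksProject]
* U. Görtz, T. Wedhorn, *Algebraic Geometry I*, 2nd ed. 2020, (13.19), Prop. 7.30. [GortzWedhorn2020]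
-/

-- `Summit.<Summit>.<Sub>.Theorems` with `Sub = Summit` (single-conjunct summit, D-0017)
set_option linter.dupNamespace false

noncomputable section

open CategoryTheory AlgebraicGeometry TopologicalSpace IsLocalRing
open Literature.AlgebraicGeometry.Resolution

namespace Summit.ResolutionOfSingularities.ResolutionOfSingularities.Theorems.ContactDeficit

universe u

/-! ## §1 END criterion — local algebra (res-L1-w52-idea-1, Sketch v10 §1) -/

/-- In a local domain, the ideal `(x, y)` is principal iff `x ∣ y` or `y ∣ x`.  (If `(x, y) = (g)` with `x = a g`,
`y = b g`, `g = α x + β y`, then `α a + β b = 1`, so `a` or `b` is a unit.)  [folklore] -/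
theorem span_pair_isPrincipal_iff_dvd_or_dvd {R : Type*} [CommRing R] [IsDomain R] [IsLocalRing R]
    (x y : R) : (Ideal.span {x, y}).IsPrincipal ↔ (x ∣ y ∨ y ∣ x) := by
  constructor
  · rintro ⟨g, hg⟩
    have hxg : x ∈ Ideal.span {g} := by
      rw [← Ideal.submodule_span_eq, ← hg]; exact Ideal.subset_span (by simp)
    have hyg : y ∈ Ideal.span {g} := by
      rw [← Ideal.submodule_span_eq, ← hg]; exact Ideal.subset_span (by simp)
    have hg' : g ∈ Ideal.span {x, y} := by
      rw [hg]; exact Submodule.mem_span_singleton_self g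
    obtain ⟨a, rfl⟩ := Ideal.mem_span_singleton'.mp hxg
    obtain ⟨b, rfl⟩ := Ideal.mem_span_singleton'.mp hyg
    obtain ⟨α, β, h⟩ := Ideal.mem_span_pair.mp hg'
    by_cases hg0 : g = 0
    · subst hg0; left; simp
    · have h1 : α * a + β * b = 1 := by
        have : (α * a + β * b) * g = 1 * g := by rw [one_mul]; linear_combination h
        exact mul_right_cancel₀ hg0 this
      rcases IsLocalRing.isUnit_or_isUnit_of_isUnit_add (h1 ▸ isUnit_one) with hu | hu
      · obtain ⟨u, hu⟩ := isUnit_of_mul_isUnit_right hu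
        left
        refine ⟨b * ↑u⁻¹, ?_⟩
        rw [← hu]
        calc b * g = b * ((↑u * ↑u⁻¹ : R) * g) := by simp
          _ = ↑u * g * (b * ↑u⁻¹) := by ring
      · obtain ⟨u, hu⟩ := isUnit_of_mul_isUnit_right hu
        right
        refine ⟨a * ↑u⁻¹, ?_⟩
        rw [← hu]
        calc a * g = a * ((↑u * ↑u⁻¹ : R) * g) := by simp
          _ = ↑u * g * (a * ↑u⁻¹) := by ring
  · rintro (⟨c, rfl⟩ | ⟨c, rfl⟩)
    · refine ⟨x, ?_⟩
      rw [Ideal.submodule_span_eq]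
      refine le_antisymm (Ideal.span_le.mpr ?_) (Ideal.span_mono (by simp))
      rintro z hz
      simp only [Set.mem_insert_iff, Set.mem_singleton_iff] at hz
      rcases hz with rfl | rfl
      · exact Ideal.mem_span_singleton_self z
      · exact Ideal.mem_span_singleton'.mpr ⟨c, by ring⟩
    · refine ⟨y, ?_⟩
      rw [Ideal.submodule_span_eq]
      refine le_antisymm (Ideal.span_le.mpr ?_) (Ideal.span_mono (by simp))
      rintro z hz
      simp only [Set.mem_insert_iff, Set.mem_singleton_iff] at hz
      rcases hz with rfl | rfl
      · exact Ideal.mem_span_singleton'.mpr ⟨c, by ring⟩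
      · exact Ideal.mem_span_singleton_self z

/-! ## §2 END criterion — sheaf form over `IsLocallyPrincipalAt` / `stalkIdeal` -/

variable {X : Scheme.{u}}

/-- Restricting a principal ideal of sections to a smaller affine open gives a principal ideal of
sections, generated by the restricted generator. [folklore] -/
theorem ideal_eq_span_singleton_of_le (I : X.IdealSheafData) {U V : X.affineOpens}
    (h : (V : X.Opens) ≤ U) {f : Γ(X, U)} (hf : I.ideal U = Ideal.span {f}) :
    I.ideal V = Ideal.span {X.presheaf.map (homOfLE h).op f} := by
  rw [← I.map_ideal h, hf, Ideal.map_span, Set.image_singleton]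
  rfl

/-- Two ideal sheaves locally principal at `x` are principal on a COMMON affine open
neighbourhood of `x`. [folklore] -/
theorem exists_affineOpens_ideal_eq_span_pair {A B : X.IdealSheafData} {x : X}
    (hA : IsLocallyPrincipalAt A x) (hB : IsLocallyPrincipalAt B x) :
    ∃ U : X.affineOpens, ∃ _ : x ∈ (U : X.Opens), ∃ f g : Γ(X, U),
      A.ideal U = Ideal.span {f} ∧ B.ideal U = Ideal.span {g} := by
  obtain ⟨UA, hxA, f, hf⟩ := hA
  obtain ⟨UB, hxB, g, hg⟩ := hB
  obtain ⟨_, ⟨U, hU, rfl⟩, hxU, hUsub⟩ :=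
    X.isBasis_affineOpens.exists_subset_of_mem_open (a := x) (Set.mem_inter hxA hxB)
      ((UA : X.Opens).isOpen.inter (UB : X.Opens).isOpen)
  have hUA : U ≤ (UA : X.Opens) := fun y hy => (hUsub hy).1
  have hUB : U ≤ (UB : X.Opens) := fun y hy => (hUsub hy).2
  exact ⟨⟨U, hU⟩, hxU, _, _, ideal_eq_span_singleton_of_le A (V := ⟨U, hU⟩) hUA hf,
    ideal_eq_span_singleton_of_le B (V := ⟨U, hU⟩) hUB hg⟩

/-- **END criterion, one direction, at a point (no Noetherian hypothesis).** If `A` and `B` are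
locally principal at `x` and `A_x ≤ B_x` in `𝒪_{X,x}`, then `A ⊔ B` is locally principal at `x`:
with `A = (f)`, `B = (g)` near `x`, the relation `f_x = c · g_x` holds on an affine neighbourhood,
where then `A ⊔ B = (g)`. [cite: StacksProject, Tag 01WR] -/
theorem isLocallyPrincipalAt_sup_of_stalkIdeal_le {A B : X.IdealSheafData} {x : X}
    (hA : IsLocallyPrincipalAt A x) (hB : IsLocallyPrincipalAt B x)
    (hle : stalkIdeal A x ≤ stalkIdeal B x) : IsLocallyPrincipalAt (A ⊔ B) x := by
  obtain ⟨U, hxU, f, g, hf, hg⟩ := exists_affineOpens_ideal_eq_span_pair hA hB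
  -- `f_x = c · g_x`
  have hfx : (X.presheaf.germ U x hxU).hom f ∈ stalkIdeal B x := by
    refine hle ?_
    rw [stalkIdeal_eq_map_germ A U hxU, hf]
    exact Ideal.mem_map_of_mem _ (Ideal.mem_span_singleton_self f)
  rw [stalkIdeal_eq_map_germ B U hxU, hg, Ideal.map_span, Set.image_singleton,
    Ideal.mem_span_singleton'] at hfx
  obtain ⟨c, hc⟩ := hfx
  -- `c` is the germ of a section `c'` on some `W' ∋ x`, `W' ⊆ U`
  obtain ⟨W', hW'U, hxW', c', hc'⟩ := X.presheaf.exists_le_germ_eq c hxU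
  have hgerm : (X.presheaf.germ W' x hxW').hom (X.presheaf.map (homOfLE hW'U).op f) =
      (X.presheaf.germ W' x hxW').hom (c' * X.presheaf.map (homOfLE hW'U).op g) := by
    rw [map_mul]
    change X.presheaf.germ W' x hxW' (X.presheaf.map (homOfLE hW'U).op f) =
      X.presheaf.germ W' x hxW' c' * X.presheaf.germ W' x hxW' (X.presheaf.map (homOfLE hW'U).op g)
    rw [TopCat.Presheaf.germ_res_apply, TopCat.Presheaf.germ_res_apply, hc']
    exact hc.symm
  -- the two sections agree on an AFFINE open neighbourhood `W ⊆ W'` of `x`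
  obtain ⟨W₀, hxW, hW, hWW', hWW'', hWeq⟩ :=
    TopCat.Presheaf.germ_eq_of_isBasis X.isBasis_affineOpens X.presheaf x hxW' hxW' hgerm
  set W : X.affineOpens := ⟨W₀, hW⟩
  have hWU : (W : X.Opens) ≤ U := hWW'.trans hW'U
  have e1 : X.presheaf.map (homOfLE hWW').op (X.presheaf.map (homOfLE hW'U).op f) =
      X.presheaf.map (homOfLE hWU).op f := by
    rw [← CommRingCat.comp_apply, ← Functor.map_comp]
    rfl
  have e2 : X.presheaf.map (homOfLE hWW'').op (c' * X.presheaf.map (homOfLE hW'U).op g) =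
      X.presheaf.map (homOfLE hWW'').op c' * X.presheaf.map (homOfLE hWU).op g := by
    rw [map_mul, ← CommRingCat.comp_apply (X.presheaf.map (homOfLE hW'U).op),
      ← Functor.map_comp]
    rfl
  rw [e1, e2] at hWeq
  -- on `W`: `A ⊔ B = (f|W, g|W) = (g|W)`
  refine ⟨W, hxW, X.presheaf.map (homOfLE hWU).op g, ?_⟩
  rw [Scheme.IdealSheafData.ideal_sup, Pi.sup_apply, ideal_eq_span_singleton_of_le A hWU hf,
    ideal_eq_span_singleton_of_le B hWU hg]
  refine le_antisymm (sup_le ?_ le_rfl) le_sup_right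
  rw [Ideal.span_singleton_le_iff_mem, Ideal.mem_span_singleton', hWeq]
  exact ⟨_, rfl⟩

/-- **END criterion (sheaf form, = card C `PairEnd` with local principality for Cartier).**
If `A`, `B` are locally principal and locally comparable (`A_x ≤ B_x` or `B_x ≤ A_x` at every
point) then `A ⊔ B` is locally principal. [cite: StacksProject, Tag 01WR] -/
theorem isLocallyPrincipal_sup_of_stalkIdeal_le_or_le {A B : X.IdealSheafData}
    (hA : IsLocallyPrincipal A) (hB : IsLocallyPrincipal B)
    (h : ∀ x : X, stalkIdeal A x ≤ stalkIdeal B x ∨ stalkIdeal B x ≤ stalkIdeal A x) :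
    IsLocallyPrincipal (A ⊔ B) := fun x => by
  rcases h x with hle | hle
  · exact isLocallyPrincipalAt_sup_of_stalkIdeal_le (hA x) (hB x) hle
  · rw [sup_comm]
    exact isLocallyPrincipalAt_sup_of_stalkIdeal_le (hB x) (hA x) hle

/-- **`PairEnd` (res-L1-w52-idea-1, Sketch v10 §2, T11-2), unfolded and proved.** The sum of two
effective Cartier ideal sheaves that are locally comparable is locally principal.
[cite: GortzWedhorn2020, (13.19) p. 413] [cite: StacksProject, Tag 01WR] -/
theorem isLocallyPrincipal_sup_of_isEffectiveCartier {A B : X.IdealSheafData}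
    (hA : IsEffectiveCartier A) (hB : IsEffectiveCartier B)
    (h : ∀ x : X, stalkIdeal A x ≤ stalkIdeal B x ∨ stalkIdeal B x ≤ stalkIdeal A x) :
    IsLocallyPrincipal (A ⊔ B) :=
  isLocallyPrincipal_sup_of_stalkIdeal_le_or_le hA.isLocallyPrincipal hB.isLocallyPrincipal h

/-! ## §3 The converse at a point whose local ring is a domain -/

/-- If `A_x = (a)`, `B_x = (b)` and `(A ⊔ B)_x = (a, b)` is principal in the local DOMAIN
`𝒪_{X,x}`, then `A_x ≤ B_x` or `B_x ≤ A_x` (by `span_pair_isPrincipal_iff_dvd_or_dvd`). [folklore] -/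
theorem stalkIdeal_le_or_le_of_isPrincipal {A B : X.IdealSheafData} {x : X}
    [IsDomain (X.presheaf.stalk x)]
    (hA : IsLocallyPrincipalAt A x) (hB : IsLocallyPrincipalAt B x)
    (h : (stalkIdeal (A ⊔ B) x).IsPrincipal) :
    stalkIdeal A x ≤ stalkIdeal B x ∨ stalkIdeal B x ≤ stalkIdeal A x := by
  obtain ⟨a, ha⟩ := hA.isPrincipal_stalkIdeal
  obtain ⟨b, hb⟩ := hB.isPrincipal_stalkIdeal
  replace ha : stalkIdeal A x = Ideal.span {a} := ha
  replace hb : stalkIdeal B x = Ideal.span {b} := hb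
  rw [stalkIdeal_sup, ha, hb, ← Ideal.span_insert] at h
  rw [ha, hb, Ideal.span_singleton_le_span_singleton, Ideal.span_singleton_le_span_singleton]
  exact ((span_pair_isPrincipal_iff_dvd_or_dvd a b).mp h).symm

/-- **END criterion at a point with domain local ring (iff).** For `A`, `B` locally principal at
`x`: `A ⊔ B` is locally principal at `x` iff `A_x ≤ B_x` or `B_x ≤ A_x`. [cite: StacksProject, Tag 01WR] -/
theorem isLocallyPrincipalAt_sup_iff {A B : X.IdealSheafData} {x : X}
    [IsDomain (X.presheaf.stalk x)]
    (hA : IsLocallyPrincipalAt A x) (hB : IsLocallyPrincipalAt B x) :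
    IsLocallyPrincipalAt (A ⊔ B) x ↔
      (stalkIdeal A x ≤ stalkIdeal B x ∨ stalkIdeal B x ≤ stalkIdeal A x) := by
  refine ⟨fun h => stalkIdeal_le_or_le_of_isPrincipal hA hB h.isPrincipal_stalkIdeal, ?_⟩
  rintro (hle | hle)
  · exact isLocallyPrincipalAt_sup_of_stalkIdeal_le hA hB hle
  · rw [sup_comm]
    exact isLocallyPrincipalAt_sup_of_stalkIdeal_le hB hA hle

/-- **END criterion on an integral scheme (iff, global).** For locally principal `A`, `B` on an
integral scheme, `A ⊔ B` is locally principal iff `A` and `B` are locally comparable.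
[cite: StacksProject, Tag 01WR] -/
theorem isLocallyPrincipal_sup_iff [IsIntegral X] {A B : X.IdealSheafData}
    (hA : IsLocallyPrincipal A) (hB : IsLocallyPrincipal B) :
    IsLocallyPrincipal (A ⊔ B) ↔
      ∀ x : X, stalkIdeal A x ≤ stalkIdeal B x ∨ stalkIdeal B x ≤ stalkIdeal A x :=
  ⟨fun h x => (isLocallyPrincipalAt_sup_iff (hA x) (hB x)).mp (h x),
    isLocallyPrincipal_sup_of_stalkIdeal_le_or_le hA hB⟩

end Summit.ResolutionOfSingularities.ResolutionOfSingularities.Theorems.ContactDeficit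

end
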